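import Literature.Probability.LatticeModels.HarmonicExtension
import Literature.Probability.LatticeModels.BoxDirichlet
import HarnessLib

/-!
# Harmonic extensions with antisymmetric data: the reflection identity and the `1/5` bound

Topic `Literature/Probability/LatticeModels`; discrete potential theory on `ℤ²` continuing
`HarmonicExtension.lean` (the solution operator `harmExt U g` of the discrete Dirichlet problem)
and `BoxDirichlet.lean` (lattice motions). Motivation: the lower bound of Duminil-Copin–Hongler–
Nolin's Lemma 10 (arXiv:0912.4253, §3.2) compares a harmonic measure with that of the *slit
half-plane* `ℍ ∖ l_k(-k)` "which has respectively wired and free boundary conditions to the left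
and to the right of `(-k, k)`; estimating this harmonic measure is straightforward". The one
non-quantitative-looking step of that estimate is made exact here by **symmetry**: if a lattice
involution `σ` preserves `U` and the data satisfy `g ∘ σ = 1 - g`, then the harmonic extension
satisfies `h ∘ σ = 1 - h` (`harmExt_reflect`, uniqueness of the Dirichlet problem), and at a site
of `U` adjacent to its own mirror image a nonnegative such `h` is at least `1/5`
(`fifth_le_harmExt_of_reflect`: `4 h(x) = ∑ h(x + e_j) ≥ h(σ x) = 1 - h(x)`). For the mirror-
symmetric **slit box** (`slitBoxDomain N H T`: the box `-N+1 ≤ X ≤ N`, `0 ≤ Y < H` minus the two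
slit columns `X ∈ {0, 1}`, `Y < T`, data `slitData = 1_{X ≤ 0}`: wired to the left of the slit,
free to the right) this gives `harmExt ≥ 1/5` on the whole column `X = 1` above the slit
(`fifth_le_harmExt_slitBox`) — the walk started just right of the top of the wall ends on the left
with probability at least `1/5`, uniformly in all sizes. Everything is PROVED; no named fact;
[folklore].

## References

* H. Duminil-Copin, C. Hongler, P. Nolin, Comm. Pure Appl. Math. 64 (2011), §3.2, Lemma 10 and
  Fig. (comparison_lower_bound) — bib key `DuminilCopinHonglerNolin2011`.
* G. Lawler, V. Limic, *Random Walk: A Modern Introduction* (2010), §6.2 (Dirichlet problem,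
  harmonic measure) — bib key `LawlerLimic2010`.
-/

noncomputable section

namespace Literature.Probability.LatticeModels

open Set

/-! ### The reflection identity -/

/-- **Reflection identity.** Let `σ` be a lattice motion with `x ∈ U ↔ σ x ∈ U` (`U` finite), and
let the data satisfy `g (σ w) = 1 - g w`. Then `harmExt U g (σ x) = 1 - harmExt U g x` for every
`x` (both sides are harmonic on `U` with the same values off `U`). [folklore] -/
theorem harmExt_reflect {U : Set (Site 2)} (hU : U.Finite) {σ : Site 2 → Site 2} (hσ : IsLatticeMotion σ)
    (hσU : ∀ x, x ∈ U ↔ σ x ∈ U) {g : Site 2 → ℝ} (hg : ∀ w, g (σ w) = 1 - g w)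
    (x : Site 2) : harmExt U g (σ x) = 1 - harmExt U g x := by
  set h := harmExt U g with hh
  have hharm := harmExt_harmonicOn hU g
  by_cases hx : x ∈ U
  · have h₁ : IsLatticeHarmonicOn (fun y => h (σ y)) U := fun y hy => by
      rw [hσ.latticeLaplacian_comp h y]
      exact hharm (σ y) ((hσU y).1 hy)
    have h₂ : IsLatticeHarmonicOn (fun y => 1 - h y) U := fun y hy => by
      have e : (fun y => 1 - h y) = fun y => (-1 : ℝ) * h y + 1 := by funext y; ring
      rw [e, latticeLaplacian_add_const, latticeLaplacian_const_mul, hharm y hy, mul_zero]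
    have hb : ∀ w ∈ latticeOuterBoundary U, (fun y => h (σ y)) w = (fun y => 1 - h y) w := by
      intro w hw
      have hwU : w ∉ U := hw.1
      have hσwU : σ w ∉ U := fun h' => hwU ((hσU w).2 h')
      show h (σ w) = 1 - h w
      rw [hh, harmExt_of_not_mem hU g hσwU, harmExt_of_not_mem hU g hwU, hg]
    exact IsLatticeHarmonicOn.eq_of_eq_boundary hU h₁ h₂ hb x hx
  · have hσx : σ x ∉ U := fun h' => hx ((hσU x).2 h')
    rw [hh, harmExt_of_not_mem hU g hσx, harmExt_of_not_mem hU g hx, hg]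

/-- **The `1/5` bound.** Under the hypotheses of `harmExt_reflect`, if moreover `g ≥ 0` and the site
`x ∈ U` is a lattice neighbour of its mirror image (`σ x = x + e_k`), then `harmExt U g x ≥ 1/5`:
harmonicity at `x` and nonnegativity give `4 h(x) ≥ h(σ x) = 1 - h(x)`. [folklore] -/
theorem fifth_le_harmExt_of_reflect {U : Set (Site 2)} (hU : U.Finite) {σ : Site 2 → Site 2} (hσ : IsLatticeMotion σ)
    (hσU : ∀ x, x ∈ U ↔ σ x ∈ U) {g : Site 2 → ℝ} (hg : ∀ w, g (σ w) = 1 - g w)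
    (hg0 : ∀ w, 0 ≤ g w) {x : Site 2} (hx : x ∈ U) {k : Fin 4} (hk : σ x = x + cornerUnit k) :
    1 / 5 ≤ harmExt U g x := by
  set h := harmExt U g with hh
  have hnonneg : ∀ y, 0 ≤ h y := le_harmExt' hU hg0
  have hrefl : h (x + cornerUnit k) = 1 - h x := by rw [← hk]; exact harmExt_reflect hU hσ hσU hg x
  have hharm := harmExt_harmonicOn hU g x hx
  rw [latticeLaplacian_eq, Fin.sum_univ_four] at hharm
  have h0 := hnonneg (x + cornerUnit 0)
  have h1 := hnonneg (x + cornerUnit 1)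
  have h2 := hnonneg (x + cornerUnit 2)
  have h3 := hnonneg (x + cornerUnit 3)
  have hsum : h (x + cornerUnit k) ≤ h (x + cornerUnit 0) + h (x + cornerUnit 1) + h (x + cornerUnit 2) + h (x + cornerUnit 3) := by
    fin_cases k <;> simp <;> linarith
  linarith

/-! ### The mirror-symmetric slit box -/

section SlitBox

variable (N H T : ℕ)

/-- The reflection across the vertical line `X = 1/2`: `(X, Y) ↦ (1 - X, Y)`. [folklore] -/
def slitReflect (v : Site 2) : Site 2 := ![1 - v 0, v 1]

/-- **The slit box**: the box `-N + 1 ≤ X ≤ N`, `0 ≤ Y < H` with the two slit columns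
`X ∈ {0, 1}`, `Y < T` removed — a bounded, two-column-wide version of the slit half-plane
`ℍ ∖ l_T` of DCHN's Lemma 10, symmetric under `slitReflect`. [folklore] -/
def slitBoxDomain : Set (Site 2) :=
  {v | -(N : ℤ) + 1 ≤ v 0 ∧ v 0 ≤ N ∧ 0 ≤ v 1 ∧ v 1 < H ∧ ¬((v 0 = 0 ∨ v 0 = 1) ∧ v 1 < T)}

/-- **The slit data**: `1` on the closed left half `X ≤ 0` (the wired side of the slit, the left
slit column, the left part of the bottom and of the outer boundary), `0` on the right half. [folklore] -/
def slitData (v : Site 2) : ℝ := if v 0 ≤ 0 then 1 else 0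

variable {N H T}

/-- Coordinates of the reflection. [folklore] -/
theorem slitReflect_apply (v : Site 2) : slitReflect v 0 = 1 - v 0 ∧ slitReflect v 1 = v 1 := by
  simp [slitReflect]

/-- The reflection is an involution. [folklore] -/
theorem slitReflect_slitReflect (v : Site 2) : slitReflect (slitReflect v) = v := by
  ext i
  fin_cases i <;> simp [slitReflect]

/-- The reflection is a lattice motion (it swaps east and west). [folklore] -/
theorem isLatticeMotion_slitReflect : IsLatticeMotion slitReflect :=
  ⟨Equiv.swap 0 2, fun x k => by
    ext i
    fin_cases i <;> fin_cases k <;> simp [slitReflect, cornerUnit, Equiv.swap_apply_of_ne_of_ne] <;> ring⟩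

/-- The slit box is symmetric. [folklore] -/
theorem mem_slitBoxDomain_iff_reflect (v : Site 2) : v ∈ slitBoxDomain N H T ↔ slitReflect v ∈ slitBoxDomain N H T := by
  simp only [slitBoxDomain, Set.mem_setOf_eq, (slitReflect_apply v).1, (slitReflect_apply v).2]
  omega

/-- The data are antisymmetric up to the constant `1`. [folklore] -/
theorem slitData_reflect (v : Site 2) : slitData (slitReflect v) = 1 - slitData v := by
  simp only [slitData, (slitReflect_apply v).1]
  by_cases h : v 0 ≤ 0
  · rw [if_pos h, if_neg (by omega)]; ring
  · rw [if_neg h, if_pos (by omega)]; ring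

/-- `0 ≤ slitData ≤ 1`. [folklore] -/
theorem slitData_mem (v : Site 2) : 0 ≤ slitData v ∧ slitData v ≤ 1 := by
  unfold slitData; split_ifs <;> norm_num

/-- The slit box is finite. [folklore] -/
theorem slitBoxDomain_finite : (slitBoxDomain N H T).Finite := by
  refine (Set.Finite.pi (t := fun i : Fin 2 => Set.Icc (if i = 0 then -(N : ℤ) + 1 else 0) (if i = 0 then (N : ℤ) else H))
    fun i => Set.finite_Icc _ _).subset ?_
  intro v hv
  rw [Set.mem_univ_pi]
  intro i
  fin_cases i
  · exact ⟨hv.1, hv.2.1⟩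
  · exact ⟨hv.2.2.1, by have := hv.2.2.2.1; simp; omega⟩

/-- **The harmonic function of the slit box** `h = harmExt (slitBoxDomain N H T) slitData`
satisfies `h ∘ σ = 1 - h`. [folklore] -/
theorem harmExt_slitBox_reflect (v : Site 2) :
    harmExt (slitBoxDomain N H T) slitData (slitReflect v) = 1 - harmExt (slitBoxDomain N H T) slitData v :=
  harmExt_reflect slitBoxDomain_finite isLatticeMotion_slitReflect mem_slitBoxDomain_iff_reflect slitData_reflect v

/-- `0 ≤ h ≤ 1` for the harmonic function of the slit box. [folklore] -/
theorem harmExt_slitBox_mem (v : Site 2) :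
    0 ≤ harmExt (slitBoxDomain N H T) slitData v ∧ harmExt (slitBoxDomain N H T) slitData v ≤ 1 :=
  ⟨le_harmExt' slitBoxDomain_finite (fun w => (slitData_mem w).1) v,
    harmExt_le' slitBoxDomain_finite (fun w => (slitData_mem w).2) v⟩

/-- Off the slit box the harmonic function is the data; in particular it vanishes on the right slit
column `{(1, Y) : Y < T}` and equals `1` on the left one. [folklore] -/
theorem harmExt_slitBox_of_not_mem {v : Site 2} (hv : v ∉ slitBoxDomain N H T) :
    harmExt (slitBoxDomain N H T) slitData v = slitData v :=
  harmExt_of_not_mem slitBoxDomain_finite slitData hv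

/-- **The `1/5` bound above the slit.** For `1 ≤ N` and `T ≤ Y < H`, the harmonic function of the
slit box is at least `1/5` at `(1, Y)` — just right of the symmetry line, above the top of the slit:
in DCHN's words, from there the walk "goes to the wired side" with probability bounded below,
uniformly in `N, H, T`. (Its mirror value at `(0, Y)` is then at most `4/5`.) [folklore] -/
theorem fifth_le_harmExt_slitBox (hN : 1 ≤ N) {v : Site 2} (h0 : v 0 = 1) (hT : (T : ℤ) ≤ v 1) (hH : v 1 < H) :
    1 / 5 ≤ harmExt (slitBoxDomain N H T) slitData v := by
  have hv : v ∈ slitBoxDomain N H T := by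
    simp only [slitBoxDomain, Set.mem_setOf_eq]
    omega
  refine fifth_le_harmExt_of_reflect slitBoxDomain_finite isLatticeMotion_slitReflect
    mem_slitBoxDomain_iff_reflect slitData_reflect (fun w => (slitData_mem w).1) hv (k := 2) ?_
  ext i
  fin_cases i <;> simp [slitReflect, cornerUnit, h0]

end SlitBox

end Literature.Probability.LatticeModels
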